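import Mathlib
import Summits.KontsevichZagierPeriods.Zeta5Search.Elimination.BoundaryDescent
import Summits.KontsevichZagierPeriods.Zeta5Search.Elimination.QBoundaryTwoTerm
import HarnessLib

/-!
# The two boundary `Q`-nodes of `Elimination.BoundaryDescent`, PROVED (cell `pub-zeta5`, fam-elim E-L32, v2)

HONEST FRAMING: systematic search; no irrationality claim unless certified.  This file proves STRUCTURE identities
for the leading coefficients `Q(a)` of Brown–Zudilin's cellular family — a two-term recursion and a closed-form
evaluation of a finite binomial double sum on a codimension-one set of parameters.  Identities between integers /
rationals: no cellular integral, no numerics, nothing about the arithmetic of `ζ(5)`, no record moves.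

OUR work (Summit side; fam-elim gen 31, 2026-08-22).  `Elimination.BoundaryDescent` (E-L30) minted two nodes on the
`Q` side of CONJECTURE D-exact, both about the BOUNDARY (`HasZeroSlot`: some dual slot `b_m = 0`, `m ∈ {1,…,7}`) of
gen-1's region inside Brown–Zudilin's cone (`DualCone`).  Both become theorems here:

* `qTwoTermBoundary_holds : QTwoTermBoundary` — the boundary two-term law
  `b_i(N+1−b_i)·Q(a) + χ_iΠ_i(b)·Q(a − s_i) = 0` (43 631 verified instances when minted) is the instance
  `W = DualCone` of `Elimination.QBoundaryTwoTerm.qTwoTermBoundary_any` (E-L31; from gen-1's Casoratian identity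
  `casUW_twoTerm`, `S₇`-transport and the gauge dictionary);
* `qBoundaryForm_holds : QBoundaryForm` — the closed form (9 476 + 374 224 verified instances when minted)

    `|Q(a)| = BF(b) = ∏_{i=1..7} (N − b_i)! / ( N! · ∏_{j∈{1,4,5,6,7}} b_j! · ∏_{jk} (N − b_j − b_k)! )`
    (`jk` over the six non-`E` pairs `16, 17, 27, 35, 45, 46`)

  at every boundary point of region ∩ cone, by induction on the slot sum along the boundary: base = all slots zero,
  which forces the corner `(N; 0⁷)` where `|Q| = 1 = BF` (`qBoundaryForm_aCorner`); step = the two-term law, the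
  positivity `χ_iΠ_i(b) > 0` on the cone (`fanCoeff_pos`) and the factorial-ratio recursion of the closed form
  `b_i(N+1−b_i)·BF(b) = χ_iΠ_i(b)·BF(b − e_i)` (`boundaryForm_lower`; bookkeeping `ψ_i·χ_i = b_i` with `ψ_i = b_i` for
  the five slots carrying a factorial `b_i!`, `ψ_i = 1` for `i ∈ {2,3}`, and one factor `N+1−b_i−b_m` per non-`E`
  partner `m` of `i`).

No D-exact statement is recorded here.  Per lead/lit g17 (2026-08-22T02:22Z) the kernel route to CONJECTURE
D-exact is cert-2's base identity `DualBaseIdentity` (route (A)); the STAR/PENCIL/boundary route of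
`Elimination.BoundaryDescent` is superseded AS A ROUTE TO D-EXACT, and its conditional corollaries
(`ctBoundaryAbs_of_twoTerm`, `dexact_cone_of_forms`, …) are deliberately NOT instantiated in this file — the two
theorems below are filed as STRUCTURE facts about `Q` alone (gen-1 D2 infrastructure: the boundary companion of the
STAR three-term family and of the terminal-value theorems).

What this is NOT: anything about CONJECTURE D-exact or the constant terms `CT(a)` (the kernel node
`LeadingCoeffIsDualConstantTerm` stays `@[conjecture]`; its kernel route is cert-2's); nothing about irrationality.

References: Brown–Zudilin [BrownZudilin2022, (17), (35), Sect. 7, Sect. 9]; tree: `Elimination.BoundaryDescent`,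
`Elimination.QBoundaryTwoTerm`, `Elimination.SignedDescentCore` (`DualCone`, `bzDen_eq_bOfA`),
`WedgeDictionaryThreeTerm` (`fanCoeff`), `WedgeDictionaryTerminalDescent` (`slotSum`),
`Families.DualConstantTermCorner`.
-/

open Finset
open scoped Nat

namespace Summit.KontsevichZagierPeriods.Zeta5Search.Elimination

open Summit.KontsevichZagierPeriods.Zeta5Search.WedgeDictionary
open Summit.KontsevichZagierPeriods.Zeta5Search.Families.Cellular (bzDen)
open Literature.NumberTheory.Irrationality.BrownZudilin2022 (bOfA QOf)

/-! ## 0. The boundary two-term law for `Q` on the cone (E-L30's node `QTwoTermBoundary`) -/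

/-- **THEOREM (was the node `QTwoTermBoundary` of `Elimination.BoundaryDescent`):** E-L31's `qTwoTermBoundary_any`
at the guard `DualCone`. -/
theorem qTwoTermBoundary_holds : QTwoTermBoundary := qTwoTermBoundary_any DualCone


/-! ## 1. The closed form written out, and its congruence -/

/-- `BF(b)` with the three products written out factor by factor. -/
def bfExplicit (b : ℕ → ℤ) : ℚ :=
  ((b 0 - b 1).toNat ! : ℚ) * (b 0 - b 2).toNat ! * (b 0 - b 3).toNat ! * (b 0 - b 4).toNat ! *
        (b 0 - b 5).toNat ! * (b 0 - b 6).toNat ! * (b 0 - b 7).toNat ! /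
    ((b 0).toNat ! * (((b 1).toNat ! : ℚ) * (b 4).toNat ! * (b 5).toNat ! * (b 6).toNat ! * (b 7).toNat !) *
      (((b 0 - b 1 - b 6).toNat ! : ℚ) * (b 0 - b 1 - b 7).toNat ! * (b 0 - b 2 - b 7).toNat ! *
        (b 0 - b 3 - b 5).toNat ! * (b 0 - b 4 - b 5).toNat ! * (b 0 - b 4 - b 6).toNat !))

/-- `BF` equals its explicit closed form. (docstring added by the filing lane, P2 g7) -/
theorem boundaryForm_eq_bfExplicit (b : ℕ → ℤ) : boundaryForm b = bfExplicit b := by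
  simp only [boundaryForm, bfExplicit, nonEPairs, List.range_succ, List.range_zero, List.map_append, List.map_cons,
    List.map_nil, List.prod_append, List.prod_cons, List.prod_nil, List.nil_append, zero_add, Nat.reduceAdd]
  ring

/-- `bfExplicit` only reads `b₀,…,b₇`. (docstring added by the filing lane, P2 g7) -/
theorem bfExplicit_congr {b b' : ℕ → ℤ} (h : ∀ n ≤ 7, b n = b' n) : bfExplicit b = bfExplicit b' := by
  simp only [bfExplicit, h 0 (by norm_num), h 1 (by norm_num), h 2 (by norm_num), h 3 (by norm_num),
    h 4 (by norm_num), h 5 (by norm_num), h 6 (by norm_num), h 7 (by norm_num)]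

/-- `BF` only reads `b₀,…,b₇`. -/
theorem boundaryForm_congr {b b' : ℕ → ℤ} (h : ∀ n ≤ 7, b n = b' n) : boundaryForm b = boundaryForm b' := by
  rw [boundaryForm_eq_bfExplicit, boundaryForm_eq_bfExplicit, bfExplicit_congr h]

/-! ## 2. The three factor moves under `b ↦ b − e_i` -/

/-- Cast of `toNat` for non-negative integers. (docstring added by the filing lane, P2 g7) -/
private theorem cast_toNat {z : ℤ} (hz : 0 ≤ z) : ((z.toNat : ℕ) : ℚ) = (z : ℚ) := by
  have h : ((z.toNat : ℕ) : ℤ) = z := Int.toNat_of_nonneg hz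
  exact_mod_cast h

/-- Numerator factor: `(N − (b−e_i)_n)! = [n = i](N+1−b_n) · (N − b_n)!`. -/
theorem numFactor_lower (b : ℕ → ℤ) (i n : ℕ) (hn : b n ≤ b 0) :
    ((b 0 - lowerAt b i n).toNat ! : ℚ) =
      (if n = i then (b 0 : ℚ) + 1 - b n else 1) * ((b 0 - b n).toNat ! : ℚ) := by
  rw [lowerAt_apply]
  by_cases h : n = i
  · subst h
    rw [if_pos rfl, if_pos rfl]
    have ht : (b 0 - (b n - 1)).toNat = (b 0 - b n).toNat + 1 := by omega
    rw [ht, Nat.factorial_succ, Nat.cast_mul, Nat.cast_add, Nat.cast_one, cast_toNat (by omega)]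
    push_cast
    ring
  · rw [if_neg h, if_neg h, one_mul]

/-- Slot factor: `((b−e_i)_n)! = b_n! / [n = i] b_n`. -/
theorem slotFactor_lower (b : ℕ → ℤ) {i : ℕ} (n : ℕ) (hi1 : 1 ≤ b i) :
    ((lowerAt b i n).toNat ! : ℚ) = ((b n).toNat ! : ℚ) / (if n = i then (b n : ℚ) else 1) := by
  rw [lowerAt_apply]
  by_cases h : n = i
  · subst h
    rw [if_pos rfl, if_pos rfl]
    have ht : (b n).toNat = (b n - 1).toNat + 1 := by omega
    rw [ht, Nat.factorial_succ, Nat.cast_mul, Nat.cast_add, Nat.cast_one, cast_toNat (by omega)]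
    have hne : (b n : ℚ) ≠ 0 := by exact_mod_cast (show b n ≠ 0 by omega)
    field_simp
    push_cast
    ring
  · rw [if_neg h, if_neg h, div_one]

/-- Pair factor: `(N − (b−e_i)_n − (b−e_i)_k)! = [i ∈ {n,k}](N+1−b_n−b_k) · (N − b_n − b_k)!`. -/
theorem pairFactor_lower (b : ℕ → ℤ) (i n k : ℕ) (hnk : n ≠ k) (hc : b n + b k ≤ b 0) :
    ((b 0 - lowerAt b i n - lowerAt b i k).toNat ! : ℚ) =
      (if n = i ∨ k = i then (b 0 : ℚ) + 1 - b n - b k else 1) * ((b 0 - b n - b k).toNat ! : ℚ) := by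
  rw [lowerAt_apply, lowerAt_apply]
  by_cases hn : n = i
  · subst hn
    rw [if_pos rfl, if_neg (fun h => hnk h.symm), if_pos (Or.inl rfl)]
    have ht : (b 0 - (b n - 1) - b k).toNat = (b 0 - b n - b k).toNat + 1 := by omega
    rw [ht, Nat.factorial_succ, Nat.cast_mul, Nat.cast_add, Nat.cast_one, cast_toNat (by omega)]
    push_cast
    ring
  · by_cases hk : k = i
    · subst hk
      rw [if_neg hn, if_pos rfl, if_pos (Or.inr rfl)]
      have ht : (b 0 - b n - (b k - 1)).toNat = (b 0 - b n - b k).toNat + 1 := by omega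
      rw [ht, Nat.factorial_succ, Nat.cast_mul, Nat.cast_add, Nat.cast_one, cast_toNat (by omega)]
      push_cast
      ring
    · rw [if_neg hn, if_neg hk, if_neg (by tauto), one_mul]

/-! ## 3. Positivity of the fan coefficient and the recursion of the closed form -/

/-- On the cone the fan coefficient `χ_i(b)·Π_i(b)` of a slot `b_i ≥ 1` is positive. -/
theorem fanCoeff_pos (b : ℕ → ℤ) {i : ℕ} (hi : i ∈ Icc 1 7) (hi1 : 1 ≤ b i)
    (hc : ∀ nk ∈ nonEPairs, b nk.1 + b nk.2 ≤ b 0) : 0 < fanCoeff b i := by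
  have hc16 : b 1 + b 6 ≤ b 0 := hc (1, 6) (by simp [nonEPairs])
  have hc17 : b 1 + b 7 ≤ b 0 := hc (1, 7) (by simp [nonEPairs])
  have hc27 : b 2 + b 7 ≤ b 0 := hc (2, 7) (by simp [nonEPairs])
  have hc35 : b 3 + b 5 ≤ b 0 := hc (3, 5) (by simp [nonEPairs])
  have hc45 : b 4 + b 5 ≤ b 0 := hc (4, 5) (by simp [nonEPairs])
  have hc46 : b 4 + b 6 ≤ b 0 := hc (4, 6) (by simp [nonEPairs])
  obtain ⟨h1, h7⟩ := mem_Icc.1 hi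
  interval_cases i <;>
    simp (config := { decide := true }) only [fanCoeff, chiOf, nonEdgePartners, List.map_cons, List.map_nil,
      List.prod_cons, List.prod_nil, ite_true, ite_false, one_mul, mul_one] <;>
    exact mul_pos (by omega) (by omega)

/-- **The factorial-ratio recursion of the closed form:** `b_i(N+1−b_i)·BF(b) = χ_iΠ_i(b)·BF(b − e_i)` for a
slot `b_i ≥ 1` of a point of the box with the six cone inequalities `b_j + b_k ≤ N` (non-`E` pairs). -/
theorem bfExplicit_lower (b : ℕ → ℤ) {i : ℕ} (hi : i ∈ Icc 1 7) (hbox : ∀ n ∈ Icc 1 7, 0 ≤ b n ∧ b n ≤ b 0)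
    (hc : ∀ nk ∈ nonEPairs, b nk.1 + b nk.2 ≤ b 0) (hi1 : 1 ≤ b i) :
    (b i : ℚ) * ((b 0 : ℚ) + 1 - b i) * bfExplicit b = (fanCoeff b i : ℚ) * bfExplicit (lowerAt b i) := by
  obtain ⟨hI1, hI7⟩ := mem_Icc.1 hi
  have h0 : lowerAt b i 0 = b 0 := lowerAt_zero b (by omega)
  have hb1 := (hbox 1 (by simp)).2
  have hb2 := (hbox 2 (by simp)).2
  have hb3 := (hbox 3 (by simp)).2
  have hb4 := (hbox 4 (by simp)).2
  have hb5 := (hbox 5 (by simp)).2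
  have hb6 := (hbox 6 (by simp)).2
  have hb7 := (hbox 7 (by simp)).2
  have hc16 : b 1 + b 6 ≤ b 0 := hc (1, 6) (by simp [nonEPairs])
  have hc17 : b 1 + b 7 ≤ b 0 := hc (1, 7) (by simp [nonEPairs])
  have hc27 : b 2 + b 7 ≤ b 0 := hc (2, 7) (by simp [nonEPairs])
  have hc35 : b 3 + b 5 ≤ b 0 := hc (3, 5) (by simp [nonEPairs])
  have hc45 : b 4 + b 5 ≤ b 0 := hc (4, 5) (by simp [nonEPairs])
  have hc46 : b 4 + b 6 ≤ b 0 := hc (4, 6) (by simp [nonEPairs])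
  have hF : ∀ n : ℕ, (n ! : ℚ) ≠ 0 := fun n => by exact_mod_cast Nat.factorial_ne_zero n
  have hbi : (b i : ℚ) ≠ 0 := by exact_mod_cast (show b i ≠ 0 by omega)
  have q16 : (b 0 : ℚ) + 1 - b 1 - b 6 ≠ 0 := by
    have h : ((b 0 + 1 - b 1 - b 6 : ℤ) : ℚ) ≠ 0 := by exact_mod_cast (show b 0 + 1 - b 1 - b 6 ≠ 0 by omega)
    push_cast at h
    exact h
  have q17 : (b 0 : ℚ) + 1 - b 1 - b 7 ≠ 0 := by
    have h : ((b 0 + 1 - b 1 - b 7 : ℤ) : ℚ) ≠ 0 := by exact_mod_cast (show b 0 + 1 - b 1 - b 7 ≠ 0 by omega)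
    push_cast at h
    exact h
  have q27 : (b 0 : ℚ) + 1 - b 2 - b 7 ≠ 0 := by
    have h : ((b 0 + 1 - b 2 - b 7 : ℤ) : ℚ) ≠ 0 := by exact_mod_cast (show b 0 + 1 - b 2 - b 7 ≠ 0 by omega)
    push_cast at h
    exact h
  have q35 : (b 0 : ℚ) + 1 - b 3 - b 5 ≠ 0 := by
    have h : ((b 0 + 1 - b 3 - b 5 : ℤ) : ℚ) ≠ 0 := by exact_mod_cast (show b 0 + 1 - b 3 - b 5 ≠ 0 by omega)
    push_cast at h
    exact h
  have q45 : (b 0 : ℚ) + 1 - b 4 - b 5 ≠ 0 := by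
    have h : ((b 0 + 1 - b 4 - b 5 : ℤ) : ℚ) ≠ 0 := by exact_mod_cast (show b 0 + 1 - b 4 - b 5 ≠ 0 by omega)
    push_cast at h
    exact h
  have q46 : (b 0 : ℚ) + 1 - b 4 - b 6 ≠ 0 := by
    have h : ((b 0 + 1 - b 4 - b 6 : ℤ) : ℚ) ≠ 0 := by exact_mod_cast (show b 0 + 1 - b 4 - b 6 ≠ 0 by omega)
    push_cast at h
    exact h
  unfold bfExplicit
  rw [h0, numFactor_lower b i 1 hb1, numFactor_lower b i 2 hb2, numFactor_lower b i 3 hb3, numFactor_lower b i 4 hb4,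
    numFactor_lower b i 5 hb5, numFactor_lower b i 6 hb6, numFactor_lower b i 7 hb7,
    pairFactor_lower b i 1 6 (by norm_num) hc16, pairFactor_lower b i 1 7 (by norm_num) hc17,
    pairFactor_lower b i 2 7 (by norm_num) hc27, pairFactor_lower b i 3 5 (by norm_num) hc35,
    pairFactor_lower b i 4 5 (by norm_num) hc45, pairFactor_lower b i 4 6 (by norm_num) hc46,
    slotFactor_lower b 1 hi1, slotFactor_lower b 4 hi1, slotFactor_lower b 5 hi1, slotFactor_lower b 6 hi1,
    slotFactor_lower b 7 hi1]
  interval_cases i <;>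
    simp (config := { decide := true }) only [fanCoeff, chiOf, nonEdgePartners, List.map_cons, List.map_nil,
      List.prod_cons, List.prod_nil, ite_true, ite_false, one_mul, mul_one, div_one, Int.cast_mul, Int.cast_sub,
      Int.cast_add, Int.cast_one] <;>
    field_simp <;> ring

/-- The recursion for `boundaryForm`. -/
theorem boundaryForm_lower (b : ℕ → ℤ) {i : ℕ} (hi : i ∈ Icc 1 7) (hbox : ∀ n ∈ Icc 1 7, 0 ≤ b n ∧ b n ≤ b 0)
    (hc : ∀ nk ∈ nonEPairs, b nk.1 + b nk.2 ≤ b 0) (hi1 : 1 ≤ b i) :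
    (b i : ℚ) * ((b 0 : ℚ) + 1 - b i) * boundaryForm b = (fanCoeff b i : ℚ) * boundaryForm (lowerAt b i) := by
  rw [boundaryForm_eq_bfExplicit, boundaryForm_eq_bfExplicit]
  exact bfExplicit_lower b hi hbox hc hi1

/-! ## 4. Region and cone bookkeeping -/

/-- On Brown–Zudilin's cone the six non-`E` pair sums are `≤ N` (`bzDen_eq_bOfA`). -/
theorem cone_pairs {a : Fin 8 → ℤ} (hW : DualCone a) :
    ∀ nk ∈ nonEPairs, bOfA a nk.1 + bOfA a nk.2 ≤ bOfA a 0 := by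
  obtain ⟨e0, e1, e2, e3, e4, e5, e6, e7⟩ := bzDen_eq_bOfA a
  have h0 := hW 0
  have h2 := hW 2
  have h3 := hW 3
  have h4 := hW 4
  have h6 := hW 6
  have h7 := hW 7
  intro nk hnk
  simp [nonEPairs] at hnk
  rcases hnk with rfl | rfl | rfl | rfl | rfl | rfl <;> dsimp only <;> omega

/-- On the region the slots lie in `[0, N]`. -/
theorem region_box {a : Fin 8 → ℤ} {j : ℕ} (hr : RegionHyp a j) :
    ∀ n ∈ Icc 1 7, 0 ≤ bOfA a n ∧ bOfA a n ≤ bOfA a 0 := by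
  intro n hn
  have h := hr.2.2.1 n hn
  have hN := level_nonneg hr
  exact ⟨h.1, by omega⟩

/-- `b(a − s_i)` agrees with `b(a) − e_i` on the slots `0,…,7`. -/
theorem bOfA_slotDown_eq_lowerAt (a : Fin 8 → ℤ) {i : ℕ} (hi : i ∈ Icc 1 7) :
    ∀ n ≤ 7, bOfA (a + slotDown i) n = lowerAt (bOfA a) i n := by
  intro n hn
  rw [bOfA_add_slotDown a i hi n hn, lowerAt_apply]
  by_cases h : n = i
  · subst h
    simp
  · rw [if_neg h, if_neg h]

/-! ## 5. The closed form, proved -/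

/-- **THEOREM (was the node `QBoundaryForm` of `Elimination.BoundaryDescent`):** at every boundary point of
gen-1's region inside Brown–Zudilin's cone, `|Q(a)| = BF(b(a))`. -/
theorem qBoundaryForm_holds : QBoundaryForm := by
  suffices H : ∀ (s : ℕ) (a : Fin 8 → ℤ) (j : ℕ), RegionHyp a j → DualCone a → HasZeroSlot a →
      (slotSum a).toNat = s → (|QOf a| : ℚ) = boundaryForm (bOfA a) from fun a j hr hW hz => H _ a j hr hW hz rfl
  intro s
  induction s using Nat.strong_induction_on with
  | _ s ih =>
    intro a j hr hW hz hs
    by_cases h0 : ∀ m ∈ Icc 1 7, bOfA a m = 0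
    · rw [eq_aCorner_of_slots_zero hr h0]
      exact qBoundaryForm_aCorner _
    · push Not at h0
      obtain ⟨i, hi, hne⟩ := h0
      have hbox := region_box hr
      have hbi := hbox i hi
      have hpos : 1 ≤ bOfA a i := by omega
      have hi7 : i ≤ 7 := (mem_Icc.1 hi).2
      obtain ⟨m, hm, hm0⟩ := hz
      have him : i ≠ m := by
        rintro rfl
        omega
      have hz' : HasZeroSlot (a + slotDown i) :=
        ⟨m, hm, by rw [bOfA_add_slotDown a i hi m (mem_Icc.1 hm).2, if_neg (Ne.symm him)]; exact hm0⟩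
      have hr' : RegionHyp (a + slotDown i) j := regionHyp_slotDown hr hi hpos
      have hW' : DualCone (a + slotDown i) := dualCone_add_slotDown hW hi hpos
      have hge : bOfA a i ≤ slotSum a := le_slotSum hr hi
      have hlt : (slotSum (a + slotDown i)).toNat < s := by
        rw [slotSum_add_slotDown a hi]
        omega
      have ih' : (|QOf (a + slotDown i)| : ℚ) = boundaryForm (bOfA (a + slotDown i)) :=
        ih _ hlt (a + slotDown i) j hr' hW' hz' rfl
      have hcone := cone_pairs hW
      have h1 := qTwoTerm_boundary a hr hi hm him hm0 hpos
      have hfc := fanCoeff_pos (bOfA a) hi hpos hcone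
      have hb : 0 < bOfA a i := by omega
      have hb' : 0 < bOfA a 0 + 1 - bOfA a i := by omega
      have h1' : bOfA a i * (bOfA a 0 + 1 - bOfA a i) * QOf a = -(fanCoeff (bOfA a) i * QOf (a + slotDown i)) := by
        linear_combination h1
      have h3 : bOfA a i * (bOfA a 0 + 1 - bOfA a i) * |QOf a| =
          fanCoeff (bOfA a) i * |QOf (a + slotDown i)| := by
        have h4 := congrArg (fun x : ℤ => |x|) h1'
        simp only [abs_mul, abs_neg] at h4
        rwa [abs_of_pos hb, abs_of_pos hb', abs_of_pos hfc] at h4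
      have h3q : (bOfA a i : ℚ) * ((bOfA a 0 : ℚ) + 1 - bOfA a i) * (|QOf a| : ℚ) =
          (fanCoeff (bOfA a) i : ℚ) * (|QOf (a + slotDown i)| : ℚ) := by
        exact_mod_cast h3
      have hrec := boundaryForm_lower (bOfA a) hi hbox hcone hpos
      rw [ih', boundaryForm_congr (bOfA_slotDown_eq_lowerAt a hi), ← hrec] at h3q
      have hcq : (bOfA a i : ℚ) * ((bOfA a 0 : ℚ) + 1 - bOfA a i) ≠ 0 := by
        have h : ((bOfA a i * (bOfA a 0 + 1 - bOfA a i) : ℤ) : ℚ) ≠ 0 := by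
          exact_mod_cast (mul_pos hb hb').ne'
        push_cast at h
        exact h
      exact mul_left_cancel₀ hcq h3q


/-- Numeral (a genuine two-slot boundary value): `b = (4; 2,0,0,0,0,2,0)` is `a = (2,2,2,0,4,4,2,2)` with
`|Q(a)| = BF(b) = 6`. -/
example : boundaryForm (fun j => if j = 0 then 4 else if j = 1 then 2 else if j = 6 then 2 else 0) = 6 := by
  rw [boundaryForm_eq_bfExplicit]
  simp [bfExplicit]
  norm_num [Nat.factorial]

end Summit.KontsevichZagierPeriods.Zeta5Search.Elimination
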